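import Mathlib
import Literature.NumberTheory.LFunctions.SuzukiSingleOperatorKernelProofs
import Summits.RiemannHypothesis.RiemannHypothesis.Theorems.DeBrangesSuzukiDoorLaplaceWindow

/-!
# v6 «SuzukiWindowsDoorConverse» — L3: the Laplace identity `∫ K_θ(x) e^{izx} dx = Θ_θ(z)` at SMALL height

RH-FREE real/complex analysis.  Inputs (as hypotheses, discharged in the kit by the v5 modules): the kernel
growth `|K_θ(x)| ≤ D_δ e^{4δx}` for every small `δ > 0` and the holomorphy of `Θ_θ` on `ℂ₊` (both consequences
of `ξ ≠ 0` on `Re s > 1/2`).  Output: for every `z` with `Im z > 0`, `x ↦ K_θ(x)e^{izx}` is integrable and its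
integral is `Θ_θ(z)` (continuation of [Su20] Thm 1.2 (K-ii), which gives it for `Im z > 1/2`, by the identity
/-- RH-FREE auxiliary (`on`). -/
theorem on `{Im z > c₁}`).  Nothing here bears on the truth of RH.
-/

set_option linter.dupNamespace false

open MeasureTheory Set Filter Complex

namespace Summit.RiemannHypothesis.RiemannHypothesis.Theorems.SuzukiWindowsDoorConverse

open Literature.NumberTheory.LFunctions

/-- The column's inlined objects ARE the Literature objects. -/
theorem limTheta_eq_lit (θ : ℝ) : SuzukiDoor.limTheta θ = limTheta θ := rfl

/-- The column's inlined kernel IS the Literature kernel. -/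
theorem limKernel_eq_lit (θ : ℝ) : SuzukiDoor.limKernel θ = limKernel θ := rfl

/-- A continuous function vanishing on `(−∞,0)` with `|W(x)| ≤ D e^{−a x}` (`a > 0`) is in `L¹ ∩ L²(ℝ)`. -/
theorem integrable_and_memLp_of_expDecay {W : ℝ → ℝ} (hWc : Continuous W) (hW0 : ∀ x : ℝ, x < 0 → W x = 0)
    {D a : ℝ} (ha : 0 < a) (hD : ∀ x : ℝ, 0 ≤ x → |W x| ≤ D * Real.exp (-a * x)) :
    Integrable W ∧ MemLp W 2 volume := by
  have hD0 : 0 ≤ D := by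
    have h := hD 0 le_rfl
    simp only [mul_zero, Real.exp_zero, mul_one] at h
    exact (abs_nonneg _).trans h
  set g : ℝ → ℝ := (Ici (0 : ℝ)).indicator fun x => D * Real.exp (-a * x) with hg_def
  have hg_nonneg : ∀ x, 0 ≤ g x := fun x => by
    simp only [hg_def]; exact Set.indicator_nonneg (fun y _ => by positivity) _
  have hgm : AEStronglyMeasurable g volume := by
    refine AEStronglyMeasurable.indicator ?_ measurableSet_Ici
    exact (continuous_const.mul (Real.continuous_exp.comp (continuous_const.mul continuous_id))).aestronglyMeasurable
  have hg1 : Integrable g := by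
    rw [hg_def, integrable_indicator_iff measurableSet_Ici]
    rw [integrableOn_Ici_iff_integrableOn_Ioi]
    exact (exp_neg_integrableOn_Ioi 0 ha).const_mul D
  have hg2 : MemLp g 2 volume := by
    rw [memLp_two_iff_integrable_sq hgm]
    have hsq : (fun x => g x ^ 2) = (Ici (0 : ℝ)).indicator fun x => D ^ 2 * Real.exp (-(2 * a) * x) := by
      funext x
      by_cases hx : x ∈ Ici (0 : ℝ)
      · simp only [hg_def, indicator_of_mem hx, mul_pow, ← Real.exp_nat_mul]; ring_nf
      · simp only [hg_def, indicator_of_notMem hx]; ring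
    rw [hsq, integrable_indicator_iff measurableSet_Ici]
    rw [integrableOn_Ici_iff_integrableOn_Ioi]
    exact (exp_neg_integrableOn_Ioi 0 (by linarith)).const_mul _
  have hdom : ∀ x : ℝ, ‖W x‖ ≤ ‖g x‖ := by
    intro x
    rw [Real.norm_of_nonneg (hg_nonneg x), Real.norm_eq_abs]
    by_cases hx : x ∈ Ici (0 : ℝ)
    · rw [hg_def, indicator_of_mem hx]; exact hD x hx
    · have hx' : x < 0 := by simpa using hx
      rw [hW0 x hx', abs_zero]; exact hg_nonneg x
  exact ⟨hg1.mono' hWc.aestronglyMeasurable (Eventually.of_forall fun x => by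
      simpa [Real.norm_of_nonneg (hg_nonneg x)] using hdom x),
    hg2.of_le hWc.aestronglyMeasurable (Eventually.of_forall hdom)⟩

/-- RH-FREE implication (L3): the LAPLACE IDENTITY AT SMALL HEIGHT.  If `|K_θ| ≤ D_δ e^{4δ·}` for all small `δ > 0` and
`Θ_θ` is holomorphic on `ℂ₊` (both hold when `ξ ≠ 0` on `Re s > 1/2`), then for every `z ∈ ℂ₊`,
`x ↦ K_θ(x) e^{izx}` is integrable and `∫_ℝ K_θ(x) e^{izx} dx = Θ_θ(z)`. -/
theorem laplace_limKernel_eq_limTheta {θ : ℝ} (hθ : 1 < θ)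
    (hGrowth : ∀ δ : ℝ, 0 < δ → δ ≤ 1 / 16 →
      ∃ D : ℝ, ∀ x : ℝ, |SuzukiDoor.limKernel θ x| ≤ D * Real.exp (4 * δ * x))
    (hTheta : DifferentiableOn ℂ (SuzukiDoor.limTheta θ) {z : ℂ | 0 < z.im})
    {z : ℂ} (hz : 0 < z.im) :
    Integrable (fun x : ℝ => (SuzukiDoor.limKernel θ x : ℂ) * Complex.exp (I * z * (x : ℂ))) ∧
      ∫ x : ℝ, (SuzukiDoor.limKernel θ x : ℂ) * Complex.exp (I * z * (x : ℂ)) = SuzukiDoor.limTheta θ z := by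
  set K : ℝ → ℝ := SuzukiDoor.limKernel θ with hK_def
  have hKc : Continuous K := by rw [hK_def, limKernel_eq_lit]; exact Suzuki2020_thm12_continuous hθ
  have hK0 : ∀ x : ℝ, x < 0 → K x = 0 := fun x hx => by
    rw [hK_def, limKernel_eq_lit]; exact Suzuki2020_thm12_Kiii hθ hx
  -- heights: 0 < c₁ < Im z, c₁ ≤ 1/2; growth rate 4δ = c₁/2
  set c : ℝ := z.im with hc_def
  set c₁ : ℝ := min c 1 / 2 with hc₁_def
  have hc₁0 : 0 < c₁ := by rw [hc₁_def]; positivity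
  have hc₁c : c₁ < c := by
    rw [hc₁_def]; have := min_le_left c 1; linarith
  have hc₁h : c₁ ≤ 1 / 2 := by
    rw [hc₁_def]; have := min_le_right c 1; linarith
  obtain ⟨D, hD⟩ := hGrowth (c₁ / 8) (by positivity) (by linarith)
  -- the damped kernel W = K e^{−c₁ x} ∈ L², vanishing on (−∞,0)
  set W : ℝ → ℝ := fun x => K x * Real.exp (-c₁ * x) with hW_def
  have hWc : Continuous W := hKc.mul (Real.continuous_exp.comp (continuous_const.mul continuous_id))
  have hW0 : ∀ x : ℝ, x < 0 → W x = 0 := fun x hx => by simp [hW_def, hK0 x hx]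
  have hW0' : ∀ u : ℝ, u ≤ -1 → W u = 0 := fun u hu => hW0 u (by linarith)
  have hWD : ∀ x : ℝ, 0 ≤ x → |W x| ≤ D * Real.exp (-(c₁ / 2) * x) := by
    intro x hx
    rw [hW_def]; dsimp only
    rw [abs_mul, abs_of_pos (Real.exp_pos _)]
    calc |K x| * Real.exp (-c₁ * x) ≤ D * Real.exp (4 * (c₁ / 8) * x) * Real.exp (-c₁ * x) :=
          mul_le_mul_of_nonneg_right (hD x) (Real.exp_pos _).le
      _ = D * Real.exp (-(c₁ / 2) * x) := by rw [mul_assoc, ← Real.exp_add]; ring_nf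
  obtain ⟨-, hW2⟩ := integrable_and_memLp_of_expDecay hWc hW0 (by positivity : 0 < c₁ / 2) hWD
  -- pointwise: K(x) e^{i z' x} = W(x) e^{i (z' − i c₁) x}
  have hpt : ∀ (z' : ℂ) (x : ℝ), (K x : ℂ) * Complex.exp (I * z' * (x : ℂ)) =
      (W x : ℂ) * Complex.exp (I * (z' - (c₁ : ℂ) * I) * (x : ℂ)) := by
    intro z' x
    rw [hW_def]; dsimp only
    rw [Complex.ofReal_mul, Complex.ofReal_exp, mul_assoc (K x : ℂ), ← Complex.exp_add]
    congr 2
    push_cast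
    ring_nf
    rw [I_sq]; ring
  -- Λ(z') := ∫ K e^{iz'x} is holomorphic on {Im > c₁}
  set Λ : ℂ → ℂ := fun z' => ∫ x : ℝ, (K x : ℂ) * Complex.exp (I * z' * (x : ℂ)) with hΛ_def
  have hL := SuzukiDoor.differentiableOn_laplace_of_memLp hW2 hW0'
  have hΛeq : ∀ z' : ℂ, Λ z' = (fun w : ℂ => ∫ u : ℝ, (W u : ℂ) * Complex.exp (I * w * (u : ℂ))) (z' - (c₁ : ℂ) * I) := by
    intro z'; simp only [hΛ_def]; exact integral_congr_ae (Eventually.of_forall fun x => hpt z' x)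
  set U : Set ℂ := {w : ℂ | c₁ < w.im} with hU_def
  have hUo : IsOpen U := isOpen_lt continuous_const Complex.continuous_im
  have hUc : IsPreconnected U := (convex_halfSpace_im_gt c₁).isPreconnected
  have hΛd : DifferentiableOn ℂ Λ U := by
    have hshift : DifferentiableOn ℂ (fun w : ℂ => w - (c₁ : ℂ) * I) U := by fun_prop
    have hmaps : MapsTo (fun w : ℂ => w - (c₁ : ℂ) * I) U {w : ℂ | 0 < w.im} := by
      intro w hw
      simp only [hU_def, mem_setOf_eq] at hw ⊢
      simp; linarith
    have h := hL.comp hshift hmaps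
    refine h.congr fun w _ => ?_
    exact hΛeq w
  have hΘd : DifferentiableOn ℂ (SuzukiDoor.limTheta θ) U :=
    hTheta.mono fun w hw => by simp only [hU_def, mem_setOf_eq] at hw ⊢; linarith
  -- they agree near z₀ = 2i (Im > 1/2: [Su20] Thm 1.2 (K-ii))
  have hev : Λ =ᶠ[nhds ((2 : ℂ) * I)] SuzukiDoor.limTheta θ := by
    have hO : IsOpen {w : ℂ | 1 / 2 < w.im} := isOpen_lt continuous_const Complex.continuous_im
    have hmem : (2 : ℂ) * I ∈ {w : ℂ | 1 / 2 < w.im} := by simp; norm_num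
    filter_upwards [hO.mem_nhds hmem] with w hw
    replace hw : 1 / 2 < w.im := hw
    show (∫ x : ℝ, (SuzukiDoor.limKernel θ x : ℂ) * Complex.exp (I * w * (x : ℂ))) = SuzukiDoor.limTheta θ w
    rw [limKernel_eq_lit, limTheta_eq_lit]
    exact (Suzuki2020_thm12_fourier hθ hw).2
  have h2U : (2 : ℂ) * I ∈ U := by
    show c₁ < ((2 : ℂ) * I).im
    norm_num; linarith
  have hEq : EqOn Λ (SuzukiDoor.limTheta θ) U :=
    (hΛd.analyticOnNhd hUo).eqOn_of_preconnected_of_eventuallyEq (hΘd.analyticOnNhd hUo) hUc h2U hev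
  have hzU : z ∈ U := by simp only [hU_def, mem_setOf_eq]; exact hc₁c
  refine ⟨?_, hEq hzU⟩
  -- integrability at z
  have hI := SuzukiDoor.integrable_laplaceIntegrand hW2 hW0' (z := z - (c₁ : ℂ) * I) (by simp; linarith)
  exact hI.congr (Eventually.of_forall fun x => (hpt z x).symm)

end Summit.RiemannHypothesis.RiemannHypothesis.Theorems.SuzukiWindowsDoorConverse
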